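import Mathlib

/-!
# Finite-dimensional conic duality with two budgets ("Farkas core")

Helper for the stub `stub_farkas` of the line `farkas-split-menu` of the crux
`MomentParity.CubicParityLoud` (stmt-AnomalousDissipation-11465). Torus-free, `Mathlib` only.

Data: a type `X` of states, finitely many ROWS `r : X → ι → ℝ`, two BUDGETS `e d : X → ℝ` and
levels `E ε : ℝ`. The dichotomy `farkasCore`: if there is NO CERTIFICATE — no `θ : ι → ℝ`,
`λ_b, λ_c ≥ 0`, non-trivial in the sense `λ_b ≠ 0 ∨ λ_c ≠ 0 ∨ (u ↦ θ·r(u)) ≢ 0`, with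
`θ·r(u) + λ_b (E − e u) + λ_c (d u − ε) ≤ 0` for every state `u` — then there is a WITNESS: a
finitely supported probability vector `w` on states `z i` with balanced rows `Σ wᵢ r(zᵢ) = 0`,
`Σ wᵢ e(zᵢ) ≤ E` and `ε ≤ Σ wᵢ d(zᵢ)`.

Proof: in `G := ℝ^m × ℝ × ℝ`, `ℝ^m ≅ W := span (range r)` (coordinates of a linear basis), separate the
(compact, convex) hull of finitely many points `Ψ(u) = (r u, e u, d u)` from the closed convex
target `{0} × (−∞, E] × [ε, ∞)`
(`geometric_hahn_banach_compact_closed`); the recession directions of the target sign the two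
multipliers; the normalised separators good for a finite set of states form a non-empty closed subset
of the unit sphere of the finite-dimensional dual of `G`, so the finite-intersection property
(`IsCompact.inter_iInter_nonempty`) yields one separator good for all states; it is extended from `W`
to `ι → ℝ` (`LinearMap.exists_extend`). Non-triviality: a functional vanishing on `range r × 0 × 0`
and on `0 × ℝ × ℝ` vanishes on `G`. No Carathéodory bound and no limiting procedure is needed.
-/

-- `Summit.<Summit>.<Problem>` is the tree's mandated summit-side namespace (CONVENTIONS §2); for this
-- single-conjunct summit the two coincide, so the duplicate is deliberate.
set_option linter.dupNamespace false

namespace Summit.AnomalousDissipation.AnomalousDissipation.Theorems.MomentParityCubicParityLoud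

open scoped BigOperators

section Core

variable {X : Type*}

/-- Splitting a linear functional on `W × ℝ × ℝ` along the three factors:
`φ (w, a, b) = φ (w, 0, 0) + a φ (0, 1, 0) + b φ (0, 0, 1)`. [folklore] -/
theorem clm_apply_prod_eq {W : Type*} [AddCommGroup W] [Module ℝ W] [TopologicalSpace W]
    (φ : (W × ℝ × ℝ) →L[ℝ] ℝ) (w : W) (a b : ℝ) :
    φ (w, a, b) = φ (w, 0, 0) + a * φ (0, 1, 0) + b * φ (0, 0, 1) := by
  have h : ((w, a, b) : W × ℝ × ℝ) = (w, 0, 0) + a • ((0 : W), (1 : ℝ), (0 : ℝ)) +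
      b • ((0 : W), (0 : ℝ), (1 : ℝ)) := by
    ext <;> simp
  rw [h, map_add, map_add, map_smul, map_smul, smul_eq_mul, smul_eq_mul]

/-- **Normalisation.** A non-zero functional on `W × ℝ × ℝ` with sign-correct multipliers and
non-positive certificate values on a finite set of states may be rescaled to norm one. [folklore] -/
theorem exists_unit_separator {W : Type*} [NormedAddCommGroup W] [NormedSpace ℝ W]
    (ψ : X → W) (e d : X → ℝ) (E ε : ℝ) (F : Finset X) (f : (W × ℝ × ℝ) →L[ℝ] ℝ) (hf : f ≠ 0)
    (hβ : f (0, 1, 0) ≤ 0) (hγ : 0 ≤ f (0, 0, 1))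
    (hcert : ∀ u ∈ F, f (ψ u, 0, 0) + -f (0, 1, 0) * (E - e u) + f (0, 0, 1) * (d u - ε) ≤ 0) :
    ∃ φ : (W × ℝ × ℝ) →L[ℝ] ℝ, ‖φ‖ = 1 ∧ 0 ≤ -φ (0, 1, 0) ∧ 0 ≤ φ (0, 0, 1) ∧
      ∀ u ∈ F, φ (ψ u, 0, 0) + -φ (0, 1, 0) * (E - e u) + φ (0, 0, 1) * (d u - ε) ≤ 0 := by
  have hn : 0 < ‖f‖ := norm_pos_iff.2 hf
  refine ⟨‖f‖⁻¹ • f, ?_, ?_, ?_, fun u hu => ?_⟩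
  · rw [norm_smul, norm_inv, norm_norm, inv_mul_cancel₀ hn.ne']
  · rw [smul_apply, smul_eq_mul]
    nlinarith [inv_nonneg.2 hn.le, mul_nonpos_iff.2 (Or.inl ⟨inv_nonneg.2 hn.le, hβ⟩)]
  · rw [smul_apply, smul_eq_mul]
    exact mul_nonneg (inv_nonneg.2 hn.le) hγ
  · simp only [smul_apply, smul_eq_mul]
    have h := hcert u hu
    have : ‖f‖⁻¹ * f (ψ u, 0, 0) + -(‖f‖⁻¹ * f (0, 1, 0)) * (E - e u) +
        ‖f‖⁻¹ * f (0, 0, 1) * (d u - ε) =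
        ‖f‖⁻¹ * (f (ψ u, 0, 0) + -f (0, 1, 0) * (E - e u) + f (0, 0, 1) * (d u - ε)) := by ring
    rw [this]
    exact mul_nonpos_iff.2 (Or.inl ⟨inv_nonneg.2 hn.le, h⟩)

/-- **Separation for finitely many states.** If no finite family of states carries a witness
(rows balanced in `W`, energy budget `≤ E`, dissipation budget `≥ ε`), then for every finite set `F`
of states there is a norm-one functional `φ` on `W × ℝ × ℝ` with `λ_b := -φ(0,1,0) ≥ 0`,
`λ_c := φ(0,0,1) ≥ 0` and `φ(ψ u, 0, 0) + λ_b (E − e u) + λ_c (d u − ε) ≤ 0` for `u ∈ F`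
(strict separation of `conv Ψ(F)` from `{0} × (−∞,E] × [ε,∞)`, signs from the recession
directions of the target). [folklore] -/
theorem exists_separator_finset {W : Type*} [NormedAddCommGroup W] [NormedSpace ℝ W]
    (ψ : X → W) (e d : X → ℝ) (E ε : ℝ)
    (hex : ¬ ∃ (κ : Type) (_ : Fintype κ) (w : κ → ℝ) (z : κ → X), (∀ i, 0 ≤ w i) ∧
      ∑ i, w i = 1 ∧ ∑ i, w i • ψ (z i) = 0 ∧ ∑ i, w i * e (z i) ≤ E ∧ ε ≤ ∑ i, w i * d (z i))
    (F : Finset X) :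
    ∃ φ : (W × ℝ × ℝ) →L[ℝ] ℝ, ‖φ‖ = 1 ∧ 0 ≤ -φ (0, 1, 0) ∧ 0 ≤ φ (0, 0, 1) ∧
      ∀ u ∈ F, φ (ψ u, 0, 0) + -φ (0, 1, 0) * (E - e u) + φ (0, 0, 1) * (d u - ε) ≤ 0 := by
  classical
  -- the points, their hull `S` and the target `T`
  set Ψ : X → W × ℝ × ℝ := fun u => (ψ u, e u, d u) with hΨ
  set S : Set (W × ℝ × ℝ) := convexHull ℝ (Set.range fun u : F => Ψ u) with hS
  set T : Set (W × ℝ × ℝ) := {g | g.1 = 0} ∩ ({g | g.2.1 ≤ E} ∩ {g | ε ≤ g.2.2}) with hT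
  have hSc : Convex ℝ S := convex_convexHull ℝ _
  have hSk : IsCompact S := (Set.finite_range _).isCompact_convexHull ℝ
  have hTc : Convex ℝ T := by
    refine Convex.inter ?_ (Convex.inter ?_ ?_)
    · intro x hx y hy a b _ _ _
      show (a • x + b • y).1 = 0
      rw [Prod.fst_add, Prod.smul_fst, Prod.smul_fst, show x.1 = 0 from hx, show y.1 = 0 from hy,
        smul_zero, smul_zero, add_zero]
    · intro x hx y hy a b ha hb hab
      show (a • x + b • y).2.1 ≤ E
      have hx' : x.2.1 ≤ E := hx
      have hy' : y.2.1 ≤ E := hy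
      rw [Prod.snd_add, Prod.fst_add, Prod.smul_snd, Prod.smul_snd, Prod.smul_fst, Prod.smul_fst,
        smul_eq_mul, smul_eq_mul]
      have hE : a * E + b * E = E := by rw [← add_mul, hab, one_mul]
      linarith [mul_le_mul_of_nonneg_left hx' ha, mul_le_mul_of_nonneg_left hy' hb]
    · intro x hx y hy a b ha hb hab
      show ε ≤ (a • x + b • y).2.2
      have hx' : ε ≤ x.2.2 := hx
      have hy' : ε ≤ y.2.2 := hy
      rw [Prod.snd_add, Prod.snd_add, Prod.smul_snd, Prod.smul_snd, Prod.smul_snd, Prod.smul_snd,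
        smul_eq_mul, smul_eq_mul]
      have hE : a * ε + b * ε = ε := by rw [← add_mul, hab, one_mul]
      linarith [mul_le_mul_of_nonneg_left hx' ha, mul_le_mul_of_nonneg_left hy' hb]
  have hTcl : IsClosed T :=
    (isClosed_eq continuous_fst continuous_const).inter
      ((isClosed_le (continuous_fst.comp continuous_snd) continuous_const).inter
        (isClosed_le continuous_const (continuous_snd.comp continuous_snd)))
  have hdisj : Disjoint S T := by
    rw [Set.disjoint_left]
    rintro g hgS ⟨hg1, hg2, hg3⟩
    obtain ⟨κ, _, w, z, hw0, hw1, hz, hsum⟩ := mem_convexHull_iff_exists_fintype.1 hgS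
    choose j hj using hz
    have hz' : ∀ i, z i = Ψ (j i) := fun i => (hj i).symm
    refine hex ⟨κ, inferInstance, w, fun i => (j i : X), hw0, hw1, ?_, ?_, ?_⟩
    · have h1 := congrArg Prod.fst hsum
      rw [Prod.fst_sum] at h1
      simp_rw [Prod.smul_fst, hz'] at h1
      rw [h1]
      exact hg1
    · have h2 : (∑ i, w i • z i).2.1 = g.2.1 := by rw [hsum]
      rw [Prod.snd_sum, Prod.fst_sum] at h2
      simp_rw [Prod.smul_snd, Prod.smul_fst, hz', smul_eq_mul] at h2
      rw [h2]
      exact hg2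
    · have h3 : (∑ i, w i • z i).2.2 = g.2.2 := by rw [hsum]
      rw [Prod.snd_sum, Prod.snd_sum] at h3
      simp_rw [Prod.smul_snd, hz', smul_eq_mul] at h3
      rw [h3]
      exact hg3
  obtain ⟨f, s₀, t₀, hfS, hst, hfT⟩ := geometric_hahn_banach_compact_closed hSc hSk hTc hTcl hdisj
  -- the values of `f` on the target
  have f0 : f ((0 : W), (0 : ℝ), (0 : ℝ)) = 0 := by simp only [Prod.mk_zero_zero, map_zero]
  set β : ℝ := f (0, 1, 0) with hβ_def
  set γ : ℝ := f (0, 0, 1) with hγ_def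
  have hval : ∀ a b : ℝ, f ((0 : W), a, b) = a * β + b * γ := fun a b => by
    rw [clm_apply_prod_eq, f0, zero_add]
  have hb₀ : t₀ < E * β + ε * γ := by
    have h := hfT ((0 : W), E, ε) ⟨rfl, le_refl E, le_refl ε⟩
    rwa [hval] at h
  -- signs from the recession directions of the target
  have hβ : β ≤ 0 := by
    by_contra h
    push Not at h
    set t : ℝ := (E * β + ε * γ - t₀) / β with ht_def
    have ht : 0 ≤ t := div_nonneg (by linarith) h.le
    have hmem : ((0 : W), E - t, ε) ∈ T := ⟨rfl, show E - t ≤ E by linarith, le_refl ε⟩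
    have h1 := hfT _ hmem
    have h2 : t * β = E * β + ε * γ - t₀ := div_mul_cancel₀ _ h.ne'
    rw [hval] at h1
    nlinarith
  have hγ : 0 ≤ γ := by
    by_contra h
    push Not at h
    set t : ℝ := (E * β + ε * γ - t₀) / (-γ) with ht_def
    have ht : 0 ≤ t := div_nonneg (by linarith) (by linarith)
    have hmem : ((0 : W), E, ε + t) ∈ T := ⟨rfl, le_refl E, show ε ≤ ε + t by linarith⟩
    have h1 := hfT _ hmem
    have h2 : t * -γ = E * β + ε * γ - t₀ := div_mul_cancel₀ _ (by linarith)
    rw [hval] at h1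
    nlinarith
  -- certificate values on `F`
  have hcert : ∀ u ∈ F, f (ψ u, 0, 0) + -β * (E - e u) + γ * (d u - ε) < 0 := by
    intro u hu
    have hmem : Ψ u ∈ S := subset_convexHull ℝ _ ⟨⟨u, hu⟩, rfl⟩
    have h1 := hfS _ hmem
    rw [hΨ] at h1
    simp only at h1
    rw [clm_apply_prod_eq] at h1
    nlinarith
  by_cases hf : f = 0
  · -- degenerate separator: then `F` is empty, use the third coordinate functional
    have hβ0 : β = 0 := by rw [hβ_def, hf, zero_apply]
    have hγ0 : γ = 0 := by rw [hγ_def, hf, zero_apply]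
    have hF : ∀ u ∈ F, False := fun u hu => by
      have hmem : Ψ u ∈ S := subset_convexHull ℝ _ ⟨⟨u, hu⟩, rfl⟩
      have h2 := hfS _ hmem
      rw [hf, zero_apply] at h2
      rw [hβ0, hγ0] at hb₀
      linarith
    set φ₀ : (W × ℝ × ℝ) →L[ℝ] ℝ :=
      (ContinuousLinearMap.snd ℝ ℝ ℝ).comp (ContinuousLinearMap.snd ℝ W (ℝ × ℝ)) with hφ₀_def
    have hφ₀ : ∀ (w : W) (a b : ℝ), φ₀ (w, a, b) = b := fun w a b => rfl
    refine exists_unit_separator ψ e d E ε F φ₀ (fun h0 => ?_) (by rw [hφ₀])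
      (by rw [hφ₀]; exact zero_le_one) fun u hu => (hF u hu).elim
    have := hφ₀ 0 0 1
    rw [h0, zero_apply] at this
    exact zero_ne_one this
  · exact exists_unit_separator ψ e d E ε F f hf hβ hγ fun u hu => (hcert u hu).le

/-- **Farkas core (conic duality with two budgets, finite-dimensional).** For rows
`r : X → ι → ℝ`, budgets `e d : X → ℝ` and levels `E ε`: if there is no certificate
`(θ, λ_b, λ_c)` — `λ_b, λ_c ≥ 0`, non-trivial (`λ_b ≠ 0 ∨ λ_c ≠ 0 ∨ θ·r(u) ≠ 0` for some `u`),
`θ·r(u) + λ_b (E − e u) + λ_c (d u − ε) ≤ 0` for all `u` — then some finitely supported probability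
vector on states balances all rows with `Σ wᵢ e(zᵢ) ≤ E` and `ε ≤ Σ wᵢ d(zᵢ)`. Stated for
`X ι : Type` (the registered form; all uses are in `Type`). [folklore] -/
theorem farkasCore :
    ∀ {X ι : Type} [Fintype ι] (r : X → ι → ℝ) (e d : X → ℝ) (E ε : ℝ),
      (¬ ∃ (θ : ι → ℝ) (lb lc : ℝ), 0 ≤ lb ∧ 0 ≤ lc ∧
          (lb ≠ 0 ∨ lc ≠ 0 ∨ ∃ u, ∑ a, θ a * r u a ≠ 0) ∧
          ∀ u, ∑ a, θ a * r u a + lb * (E - e u) + lc * (d u - ε) ≤ 0) →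
      ∃ (κ : Type) (_ : Fintype κ) (w : κ → ℝ) (z : κ → X), (∀ i, 0 ≤ w i) ∧ ∑ i, w i = 1 ∧
        (∀ a, ∑ i, w i * r (z i) a = 0) ∧ ∑ i, w i * e (z i) ≤ E ∧ ε ≤ ∑ i, w i * d (z i) := by
  intro X ι _ r e d E ε hno
  classical
  by_contra hex
  refine hno ?_
  -- the span `W` of the rows, read in coordinates `ℝ^m`
  set W : Submodule ℝ (ι → ℝ) := Submodule.span ℝ (Set.range r) with hW_def
  set ψ₀ : X → W := fun u => ⟨r u, Submodule.subset_span ⟨u, rfl⟩⟩ with hψ₀_def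
  obtain ⟨m, ⟨eqv⟩⟩ : ∃ m : ℕ, Nonempty (W ≃ₗ[ℝ] (Fin m → ℝ)) :=
    ⟨_, ⟨(Module.finBasis ℝ W).equivFun⟩⟩
  set ψ : X → (Fin m → ℝ) := fun u => eqv (ψ₀ u) with hψ_def
  -- no finite witness, rows read in coordinates
  have hex' : ¬ ∃ (κ : Type) (_ : Fintype κ) (w : κ → ℝ) (z : κ → X), (∀ i, 0 ≤ w i) ∧
      ∑ i, w i = 1 ∧ ∑ i, w i • ψ (z i) = 0 ∧ ∑ i, w i * e (z i) ≤ E ∧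
        ε ≤ ∑ i, w i * d (z i) := by
    rintro ⟨κ, _, w, z, hw0, hw1, hr, he, hd⟩
    refine hex ⟨κ, inferInstance, w, z, hw0, hw1, fun a => ?_, he, hd⟩
    have h1 : eqv (∑ i, w i • ψ₀ (z i)) = 0 := by
      rw [map_sum]
      simp_rw [map_smul]
      exact hr
    have h2 : ∑ i, w i • ψ₀ (z i) = 0 := (LinearEquiv.map_eq_zero_iff eqv).1 h1
    have h := congrArg (fun v : W => (v : ι → ℝ) a) h2
    simp only [hψ₀_def, Submodule.coe_sum, Submodule.coe_smul, Finset.sum_apply, Pi.smul_apply,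
      smul_eq_mul, Submodule.coe_zero, Pi.zero_apply] at h
    exact h
  -- normalised sign-correct functionals `K` (compact) and certificates `C u` (closed)
  set K : Set (((Fin m → ℝ) × ℝ × ℝ) →L[ℝ] ℝ) :=
    Metric.sphere 0 1 ∩ {φ | 0 ≤ -φ (0, 1, 0)} ∩ {φ | 0 ≤ φ (0, 0, 1)} with hK_def
  set C : X → Set (((Fin m → ℝ) × ℝ × ℝ) →L[ℝ] ℝ) := fun u =>
    {φ | φ (ψ u, 0, 0) + -φ (0, 1, 0) * (E - e u) + φ (0, 0, 1) * (d u - ε) ≤ 0} with hC_def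
  have hev : ∀ x : (Fin m → ℝ) × ℝ × ℝ, Continuous fun φ : ((Fin m → ℝ) × ℝ × ℝ) →L[ℝ] ℝ => φ x :=
    fun x => continuous_eval_const x
  have hKc : IsCompact K :=
    ((isCompact_sphere _ _).inter_right (isClosed_le continuous_const (hev _).neg)).inter_right
      (isClosed_le continuous_const (hev _))
  have hCc : ∀ u, IsClosed (C u) := fun u =>
    isClosed_le (((hev _).add ((hev _).neg.mul continuous_const)).add
      ((hev _).mul continuous_const)) continuous_const
  have hfin : ∀ F : Finset X, (K ∩ ⋂ u ∈ F, C u).Nonempty := by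
    intro F
    obtain ⟨φ, h1, h2, h3, h4⟩ := exists_separator_finset ψ e d E ε hex' F
    exact ⟨φ, ⟨⟨mem_sphere_zero_iff_norm.2 h1, h2⟩, h3⟩, Set.mem_iInter₂.2 h4⟩
  obtain ⟨φ, ⟨⟨hφ1, hφ2⟩, hφ3⟩, hφC⟩ := hKc.inter_iInter_nonempty C hCc hfin
  rw [Set.mem_iInter] at hφC
  replace hφ1 : ‖φ‖ = 1 := mem_sphere_zero_iff_norm.1 hφ1
  replace hφ2 : 0 ≤ -φ (0, 1, 0) := hφ2
  replace hφ3 : 0 ≤ φ (0, 0, 1) := hφ3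
  replace hφC : ∀ u, φ (ψ u, 0, 0) + -φ (0, 1, 0) * (E - e u) + φ (0, 0, 1) * (d u - ε) ≤ 0 :=
    fun u => hφC u
  -- pull the first component of `φ` back to `W`, extend it to `ι → ℝ`, read off `θ`
  set φ₁ : (Fin m → ℝ) →ₗ[ℝ] ℝ :=
    (φ : ((Fin m → ℝ) × ℝ × ℝ) →ₗ[ℝ] ℝ).comp (LinearMap.inl ℝ (Fin m → ℝ) (ℝ × ℝ)) with hφ₁_def
  have hφ₁ : ∀ v, φ₁ v = φ (v, 0, 0) := fun v => rfl
  obtain ⟨g, hg⟩ := LinearMap.exists_extend (φ₁.comp eqv.toLinearMap)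
  have hgψ : ∀ u, g (r u) = φ (ψ u, 0, 0) := fun u => LinearMap.congr_fun hg (ψ₀ u)
  set θ : ι → ℝ := fun a => g fun j => if a = j then 1 else 0 with hθ_def
  have hθ : ∀ u, ∑ a, θ a * r u a = φ (ψ u, 0, 0) := by
    intro u
    rw [← hgψ, LinearMap.pi_apply_eq_sum_univ g (r u)]
    refine Finset.sum_congr rfl fun a _ => ?_
    rw [smul_eq_mul, hθ_def, mul_comm]
  refine ⟨θ, -φ (0, 1, 0), φ (0, 0, 1), hφ2, hφ3, ?_, fun u => ?_⟩
  · -- non-triviality: `φ ≠ 0` vanishing on `0 × ℝ × ℝ` cannot vanish on `range ψ × 0 × 0`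
    by_contra hnt
    push Not at hnt
    obtain ⟨hb, hc, hr⟩ := hnt
    have hspan : Submodule.span ℝ (Set.range ψ₀) = ⊤ := by
      have : Set.range ψ₀ = ((↑) : W → ι → ℝ) ⁻¹' Set.range r := by
        ext w
        constructor
        · rintro ⟨u, rfl⟩
          exact ⟨u, rfl⟩
        · rintro ⟨u, hu⟩
          exact ⟨u, Subtype.ext hu⟩
      rw [this]
      exact Submodule.span_span_coe_preimage
    have h0 : φ₁.comp eqv.toLinearMap = 0 := LinearMap.ext_on_range hspan fun u => by
      rw [← hg, LinearMap.zero_apply]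
      show g (r u) = 0
      rw [hgψ, ← hθ]
      exact hr u
    have hφ₁0 : ∀ v, φ₁ v = 0 := fun v => by
      have h := LinearMap.congr_fun h0 (eqv.symm v)
      rwa [LinearMap.zero_apply, LinearMap.comp_apply, LinearEquiv.coe_toLinearMap,
        LinearEquiv.apply_symm_apply] at h
    have hφ0 : φ = 0 := by
      refine ContinuousLinearMap.ext fun x => ?_
      obtain ⟨v, a, b⟩ := x
      rw [clm_apply_prod_eq, ← hφ₁, hφ₁0, hc, zero_apply, show φ (0, 1, 0) = 0 by linarith,
        mul_zero, mul_zero, add_zero, add_zero]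
    rw [hφ0, norm_zero] at hφ1
    exact zero_ne_one hφ1
  · rw [hθ]
    exact hφC u

end Core

end Summit.AnomalousDissipation.AnomalousDissipation.Theorems.MomentParityCubicParityLoud
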